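import Mathlib.MeasureTheory.Integral.MeanInequalities
import Mathlib.Analysis.SpecialFunctions.Pow.Continuity
import Mathlib.Analysis.SpecialFunctions.Pow.Real
import HarnessLib

/-!
# Seregin 2020, Lemma 2.2 (after Nazarov–Uraltseva 2012), atom M1 (`lemma22_moserStep`, one
# reverse-Hölder step of the Moser iteration): algebraic tools — the three-factor Hölder
# inequality with exponents `(3, 2, 6)`, the absorption step `y⁶ ≤ a + b y⁵ ⇒ y⁶ ≤ 2a + (2b)⁶`,
# and the power bookkeeping of the drift splitting `η v² ζ|∇ζ| = 2 w^{5/3} g`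

Helper toward the registered stub `lemma22_moserStep` of stmt-NavierStokesRegularity-15453 (crux
`AxisymmetricKatoGlobal`, Seregin 2020 Lemma 2.2 ⇐ N–U 2012 Lemma 3.1; skeleton
`Cruxes/AxisymmetricKatoGlobal/Seregin2020Lemma22ExpansionOfPositivity.lean`, M1/M2 split of
L3.1′). The drift term of the energy inequality, `∫∫ η H(Φ) ⟪U, ∇Θ²⟫` with `H(Φ) = v²`,
`v = (l-Φ)₊^{q/2}`, `Θ = φ³`, is split pointwise as
`6 η v² φ⁵ |U| |∇φ| = 2|U| · w^{5/3} · g`, `w = η^{1/2} v φ³`, `g = 3 η^{1/6} v^{1/3} |∇φ|`, and bounded by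
Hölder with exponents `(3, 2, 6)`: `≤ 2 ‖U‖₃ ‖w‖_{10/3}^{5/3} ‖g‖₆`; the `L^{10/3}` norm of `w` is
controlled by the parabolic embedding of the energy class and absorbed (N–U (3.3)–(3.5), here in
isotropic `L^p_{t,x}` norms: `3/10·(5/3) + 1/3 + 1/6 = 1`).

* `lintegral_rpow_third_half_sixth_le` — `∫ f₁^{1/3} f₂^{1/2} f₃^{1/6} ≤ (∫f₁)^{1/3} (∫f₂)^{1/2} (∫f₃)^{1/6}`;
* `pow_six_le_of_le_add_mul_pow_five` — `y⁶ ≤ a + b y⁵`, `y ≠ ∞` ⇒ `y⁶ ≤ 2a + (2b)⁶` (in `ℝ≥0∞`);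
* `drift_split_rpow`, `sq_w_rpow`, `pow_six_g_rpow` — the real-power identities behind the splitting.

## References

* A. I. Nazarov, N. N. Uraltseva, St. Petersburg Math. J. 23 (2012) 93–115 = arXiv:1011.1888,
  §3, Lemma 3.1, (3.2)–(3.6), Remarks 5, 6, 9. [NazarovUraltseva2012]
* G. Seregin, Anal. Math. Phys. 10 (2020), Paper 46 = arXiv:2006.04140, Lemma 2.2. [Seregin2020]
-/

-- the problem directory repeats the summit name (D-0017); core's `dupNamespace` linter fires
set_option linter.dupNamespace false

noncomputable section

open MeasureTheory Set Function Filter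
open scoped NNReal ENNReal

namespace Summit.NavierStokesRegularity.NavierStokesRegularity.Theorems.AxisymmetricKatoGlobal.EulerScaling

/-! ### Hölder with three factors -/

/-- **Hölder's inequality with exponents `(3, 2, 6)`** in the form
`∫ f₁^{1/3} f₂^{1/2} f₃^{1/6} ≤ (∫ f₁)^{1/3} (∫ f₂)^{1/2} (∫ f₃)^{1/6}` (`1/3 + 1/2 + 1/6 = 1`;
Mathlib's finite-family Hölder `ENNReal.lintegral_prod_norm_pow_le`). [cite: NazarovUraltseva2012, proof of Lemma 3.1, display after (3.2) (Hölder for the drift term)] -/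
theorem lintegral_rpow_third_half_sixth_le {α : Type*} [MeasurableSpace α] {μ : Measure α}
    {f₁ f₂ f₃ : α → ℝ≥0∞} (h₁ : AEMeasurable f₁ μ) (h₂ : AEMeasurable f₂ μ)
    (h₃ : AEMeasurable f₃ μ) :
    ∫⁻ a, f₁ a ^ ((1 : ℝ) / 3) * f₂ a ^ ((1 : ℝ) / 2) * f₃ a ^ ((1 : ℝ) / 6) ∂μ ≤
      (∫⁻ a, f₁ a ∂μ) ^ ((1 : ℝ) / 3) * (∫⁻ a, f₂ a ∂μ) ^ ((1 : ℝ) / 2) *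
        (∫⁻ a, f₃ a ∂μ) ^ ((1 : ℝ) / 6) := by
  have h := ENNReal.lintegral_prod_norm_pow_le (μ := μ) (Finset.univ : Finset (Fin 3))
    (f := ![f₁, f₂, f₃]) (fun i _ => by fin_cases i <;> assumption)
    (p := ![(1 : ℝ) / 3, (1 : ℝ) / 2, (1 : ℝ) / 6]) (by simp [Fin.sum_univ_three, Matrix.cons_val]; norm_num)
    (fun i _ => by fin_cases i <;> simp)
  simpa [Fin.prod_univ_three, mul_assoc] using h

/-! ### The absorption step -/

/-- **Absorption**: in `ℝ≥0∞`, if `y ≠ ∞` and `y⁶ ≤ a + b·y⁵` then `y⁶ ≤ 2a + (2b)⁶`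
(if `y ≤ 2b` the second bound holds; otherwise `b y⁵ ≤ y⁶/2` is absorbed). This replaces Young's
inequality in N–U's `‖vζ‖²_𝒱 ≤ … + ‖b‖ ‖vζ‖^{2-1/s} (…)^{1/s}`. [cite: NazarovUraltseva2012, proof of Lemma 3.1, (3.3) («and the Young inequality»)] -/
theorem pow_six_le_of_le_add_mul_pow_five {y a b : ℝ≥0∞} (hy : y ≠ ∞)
    (h : y ^ 6 ≤ a + b * y ^ 5) : y ^ 6 ≤ 2 * a + (2 * b) ^ 6 := by
  rcases le_or_gt y (2 * b) with hyb | hyb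
  · calc y ^ 6 ≤ (2 * b) ^ 6 := pow_le_pow_left' hyb 6
      _ ≤ 2 * a + (2 * b) ^ 6 := le_add_self
  · -- `2b < y`: then `2 (b y⁵) ≤ y⁶`, which is absorbed
    have hy6 : y ^ 6 ≠ ∞ := ENNReal.pow_ne_top hy
    have h2 : 2 * (b * y ^ 5) ≤ y ^ 6 := by
      calc 2 * (b * y ^ 5) = (2 * b) * y ^ 5 := by ring
        _ ≤ y * y ^ 5 := by gcongr
        _ = y ^ 6 := by ring
    have h3 : y ^ 6 + y ^ 6 ≤ 2 * a + y ^ 6 := by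
      calc y ^ 6 + y ^ 6 = 2 * y ^ 6 := (two_mul _).symm
        _ ≤ 2 * (a + b * y ^ 5) := by gcongr
        _ = 2 * a + 2 * (b * y ^ 5) := by ring
        _ ≤ 2 * a + y ^ 6 := by gcongr
    have h4 : y ^ 6 ≤ 2 * a := (ENNReal.add_le_add_iff_right hy6).1 h3
    exact h4.trans le_self_add

/-! ### Power bookkeeping for the splitting `η v² ζ|∇ζ| = 2 w^{5/3} g` -/

/-- `(x^{1/6})^6 = x` for `x ≥ 0`. [folklore] -/
theorem rpow_sixth_pow_six {x : ℝ} (hx : 0 ≤ x) : (x ^ ((1 : ℝ) / 6)) ^ (6 : ℕ) = x := by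
  rw [← Real.rpow_natCast, ← Real.rpow_mul hx]; norm_num

/-- `(x^{a/6})^6 = x^a` for `x ≥ 0`. [folklore] -/
theorem rpow_div_six_pow_six {x : ℝ} (hx : 0 ≤ x) (a : ℝ) :
    (x ^ (a / 6)) ^ (6 : ℕ) = x ^ a := by
  rw [← Real.rpow_natCast, ← Real.rpow_mul hx]
  congr 1; push_cast; ring

/-- `(x^{1/2})^2 = x` for `x ≥ 0`. [folklore] -/
theorem rpow_half_sq' {x : ℝ} (hx : 0 ≤ x) : (x ^ ((1 : ℝ) / 2)) ^ (2 : ℕ) = x := by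
  rw [← Real.rpow_natCast, ← Real.rpow_mul hx]; norm_num

/-- `(x^{a/2})^2 = x^a` for `x ≥ 0`. [folklore] -/
theorem rpow_div_two_sq {x : ℝ} (hx : 0 ≤ x) (a : ℝ) : (x ^ (a / 2)) ^ (2 : ℕ) = x ^ a := by
  rw [← Real.rpow_natCast, ← Real.rpow_mul hx]
  congr 1; push_cast; ring

/-- **The square of `w = η^{1/2} v φ³`**, `v = V^{q/2}`: `w² = η V^q φ⁶` (`η, V ≥ 0`). [folklore] -/
theorem sq_w_rpow {η V φ q : ℝ} (hη : 0 ≤ η) (hV : 0 ≤ V) :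
    (η ^ ((1 : ℝ) / 2) * V ^ (q / 2) * φ ^ 3) ^ 2 = η * V ^ q * φ ^ 6 := by
  rw [mul_pow, mul_pow, rpow_half_sq' hη, rpow_div_two_sq hV]; ring

/-- **`w^{5/3}` through the sixth roots**: for `w = η^{1/2} V^{q/2} φ³ ≥ 0` one has
`w^{5/3} = (η^{1/6} V^{q/6} φ)^5` (`η, V, φ ≥ 0`). [folklore] -/
theorem w_rpow_five_thirds {η V φ q : ℝ} (hη : 0 ≤ η) (hV : 0 ≤ V) (hφ : 0 ≤ φ) :
    (η ^ ((1 : ℝ) / 2) * V ^ (q / 2) * φ ^ 3) ^ ((5 : ℝ) / 3) =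
      (η ^ ((1 : ℝ) / 6) * V ^ (q / 6) * φ) ^ (5 : ℕ) := by
  have hA : 0 ≤ η ^ ((1 : ℝ) / 6) * V ^ (q / 6) * φ :=
    mul_nonneg (mul_nonneg (Real.rpow_nonneg hη _) (Real.rpow_nonneg hV _)) hφ
  have e1 : η ^ ((1 : ℝ) / 2) = (η ^ ((1 : ℝ) / 6)) ^ (3 : ℕ) := by
    rw [← Real.rpow_natCast, ← Real.rpow_mul hη]; norm_num
  have e2 : V ^ (q / 2) = (V ^ (q / 6)) ^ (3 : ℕ) := by
    rw [← Real.rpow_natCast, ← Real.rpow_mul hV]; congr 1; push_cast; ring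
  have hw : η ^ ((1 : ℝ) / 2) * V ^ (q / 2) * φ ^ 3 =
      (η ^ ((1 : ℝ) / 6) * V ^ (q / 6) * φ) ^ (3 : ℕ) := by
    rw [e1, e2]; ring
  rw [hw, ← Real.rpow_natCast _ 3, ← Real.rpow_mul hA, ← Real.rpow_natCast _ 5]
  congr 1; push_cast; norm_num

/-- **The drift splitting, pointwise**: with `A = η^{1/6} V^{q/6}` (so that `η V^q = A⁶`,
`w^{5/3} = (Aφ)⁵`, `g = 3 A b`), `6 η V^q φ⁵ a b = 2a · (Aφ)⁵ · (3 A b)` — i.e.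
`η H(Φ) |⟪U, ∇(φ⁶)⟩| ≤ 2|U| w^{5/3} g` with equality for `⟪U,∇φ⟩` of one sign. [cite: NazarovUraltseva2012, proof of Lemma 3.1, display after (3.2) (splitting v²ζ|Dζ| = (vζ)^{2-1/s}(vζ^{1-s}|Dζ|^s)^{1/s})] -/
theorem drift_split_rpow {η V φ q a b : ℝ} (hη : 0 ≤ η) (hV : 0 ≤ V) (hφ : 0 ≤ φ) :
    6 * (η * V ^ q) * φ ^ 5 * a * b =
      2 * a * (η ^ ((1 : ℝ) / 2) * V ^ (q / 2) * φ ^ 3) ^ ((5 : ℝ) / 3) *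
        (3 * (η ^ ((1 : ℝ) / 6) * V ^ (q / 6)) * b) := by
  rw [w_rpow_five_thirds hη hV hφ]
  have h1 : η * V ^ q = (η ^ ((1 : ℝ) / 6) * V ^ (q / 6)) ^ (6 : ℕ) := by
    rw [mul_pow, rpow_sixth_pow_six hη, rpow_div_six_pow_six hV]
  rw [h1]; ring

/-- **`g⁶ = 729 η V^q b⁶`** for `g = 3 η^{1/6} V^{q/6} b` (`η, V ≥ 0`). [folklore] -/
theorem pow_six_g_rpow {η V q b : ℝ} (hη : 0 ≤ η) (hV : 0 ≤ V) :
    (3 * (η ^ ((1 : ℝ) / 6) * V ^ (q / 6)) * b) ^ (6 : ℕ) = 729 * (η * V ^ q) * b ^ 6 := by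
  rw [mul_pow, mul_pow, mul_pow, rpow_sixth_pow_six hη, rpow_div_six_pow_six hV]; norm_num

/-- **`w^{10/3} = (w²)^{5/3}`** and, where `η = φ = 1`, `w^{10/3} = V^{(5/3)q}`: the integrand of
the reverse-Hölder left-hand side. [folklore] -/
theorem rpow_ten_thirds_eq {w : ℝ} (hw : 0 ≤ w) : w ^ ((10 : ℝ) / 3) = (w ^ 2) ^ ((5 : ℝ) / 3) := by
  rw [← Real.rpow_natCast w 2, ← Real.rpow_mul hw]; norm_num

/-- `(V^q)^{5/3} = V^{(5/3) q}` for `V ≥ 0`. [folklore] -/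
theorem rpow_rpow_five_thirds {V : ℝ} (hV : 0 ≤ V) (q : ℝ) :
    (V ^ q) ^ ((5 : ℝ) / 3) = V ^ (5 / 3 * q) := by
  rw [← Real.rpow_mul hV]; congr 1; ring

end Summit.NavierStokesRegularity.NavierStokesRegularity.Theorems.AxisymmetricKatoGlobal.EulerScaling

end
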